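import Literature.Barriers.CriticalPhenomena.GaussianDominationRouteLaceExpansionMeasurable
import Literature.Probability.Percolation.ClusterBoundary
import HarnessLib

/-!
# Towards `HaraSlade1990_infraredBound_holds`, XII: the combinatorics of pivotal bonds and the
# cutting-bond partition (Heydenreich–van der Hofstad 2017, Lemma 6.5)

Sibling proof file of `GaussianDominationRouteLaceExpansion.lean` (barrier catalogue
`Literature/Barriers/CriticalPhenomena/`), first of the files discharging the named fact
`HvdH2017_prop61` (Prop. 6.1, the inclusion–exclusion lace expansion). The derivation of Prop. 6.1
rests on two lemmas about a single expansion step: the cutting-bond PARTITION (Lemma 6.5 /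
Slade 2006 (10.22)),

  `{v ↔ x through A} = E'(v,x;A) ⊔ ⊔_{(a,b)} [E'(v,a;A) ∩ {(a,b) occupied and pivotal for v → x}]`,

and the cutting-bond LEMMA 6.4 (conditioning on the restricted cluster). This file proves the
deterministic, configuration-wise content of Lemma 6.5 for the tree's definitions
(`restrCluster`, `IsPivotalBond` in the intrinsic form of Slade 2006 (9.76), `connThrough`, `laceE`):

* the EXIT principle: an open bond leaving `C̃^{(a,b)}(v)` is the bond `{a,b}`
  (`edge_eq_of_adj_of_mem_restrCluster`), whence every open path from inside `C̃` to outside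
  splits at the directed bond `(a,b)` (`pathIn_prefix_of_exit`, `pathIn_suffix_of_exit`);
* pivotal bonds for `v → x` are open when `v ↔ x` (`mem_of_isPivotalBond`), compose
  (`IsPivotalBond.of_pivotal_left`) and are LINEARLY ORDERED (`isPivotalBond_trichotomy`);
* Lemma 6.5: every configuration of `{v ↔ x through A} ∖ E'(v,x;A)` has a cutting bond
  (`exists_cuttingBond`, by induction on the length of an open walk: a pivotal bond for `v → a`
  lies on every open walk from `v` to `a`), the cutting bond is unique (`cuttingBond_unique`),
  the pieces lie in `{v ↔ x through A}` (`connThrough_of_cut`) and miss `E'(v,x;A)`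
  (`not_laceE_of_cut`); together: `mem_connThrough_iff_laceE_or_cut`.

The measure-theoretic form of the partition and Lemma 6.4 follow in sibling files.

## References

* M. Heydenreich, R. van der Hofstad, *Progress in High-Dimensional Percolation and Random
  Graphs* (Springer 2017): Def. 6.2, Def. 6.3, (6.2.11), (6.2.12), Lemma 6.5 (Exercise 6.3).
* G. Slade, *The Lace Expansion and its Applications* (LNM 1879, 2006): Def. 9.13, (9.76),
  (10.11), (10.12), (10.22).
-/

noncomputable section

namespace Literature.Barriers.CriticalPhenomena

open Literature.Probability.LatticeModels Literature.Probability.Percolation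
open Literature.Probability.Percolation.DCT16

variable {d : ℕ}

/-! ### Paths in the open graph -/

/-- A path inside `univ` of the open graph is the same as reachability. [folklore] -/
theorem pathIn_univ_iff_reachable {V : Type*} {ω : BondConfig V} {x y : V} :
    PathIn (openGraph ω) Set.univ x y ↔ (openGraph ω).Reachable x y := by
  refine ⟨reachable_of_pathIn, fun h => ?_⟩
  obtain ⟨w⟩ := h
  exact pathIn_of_walk_support_subset w fun _ _ => Set.mem_univ _

/-- Adjacency in the open graph of `ω ∖ {e}`: open in `ω` and not the bond `e`. [folklore] -/
theorem openGraph_sdiff_adj {V : Type*} (ω : BondConfig V) (e : Sym2 V) (x y : V) :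
    (openGraph (ω \ {e})).Adj x y ↔ (openGraph ω).Adj x y ∧ s(x, y) ≠ e := by
  simp only [openGraph_adj, Set.mem_sdiff, Set.mem_singleton_iff]
  tauto

/-- A path of `ω` inside a set `B` missing an endpoint `w` of the bond `e` never uses `e`, so it
is a path of `ω ∖ {e}`. [folklore] -/
theorem pathIn_sdiff_of_notMem {e : Sym2 (Site d)} {w x y : Site d} {B : Set (Site d)}
    {ω : BondConfig (Site d)} (hw : w ∈ e) (hwB : w ∉ B) (hp : PathIn (openGraph ω) B x y) :
    PathIn (openGraph (ω \ {e})) B x y := by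
  refine pathIn_congrGraph (fun c c' hc hc' hadj => (openGraph_sdiff_adj ω e c c').2 ⟨hadj, fun h => ?_⟩) hp
  rw [← h] at hw
  rcases Sym2.mem_iff.1 hw with rfl | rfl
  · exact hwB hc
  · exact hwB hc'

/-! ### The restricted cluster `C̃^{(a,b)}(v)` and the exit principle -/

/-- `z ∈ C̃^{(a,b)}(v)` iff there is an open path from `v` to `z` avoiding the bond `{a,b}`.
[cite: HeydenreichVanDerHofstad2017, Def. 6.3(b)] -/
theorem mem_restrCluster_iff_pathIn {a b v z : Site d} {ω : BondConfig (Site d)} :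
    z ∈ restrCluster a b v ω ↔ PathIn (openGraph (ω \ {s(a, b)})) Set.univ v z := by
  rw [mem_restrCluster_iff, pathIn_univ_iff_reachable]

/-- `C̃^{(a,b)}(v) ⊆ C(v)`. [cite: HeydenreichVanDerHofstad2017, Def. 6.3(b)] -/
theorem reachable_of_mem_restrCluster {a b v z : Site d} {ω : BondConfig (Site d)}
    (h : z ∈ restrCluster a b v ω) : (openGraph ω).Reachable v z := by
  have h' : (openGraph (ω \ {s(a, b)})).Reachable v z := h
  exact h'.mono (openGraph_mono Set.sdiff_subset)

/-- **Exit principle.** An open bond of `ω` joining a vertex of `C̃^{(a,b)}(v)` to a vertex outside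
it is the bond `{a,b}` (any other open bond would extend the restricted cluster).
[cite: HeydenreichVanDerHofstad2017, Def. 6.3(b)–(c)] -/
theorem edge_eq_of_adj_of_mem_restrCluster {a b v c c' : Site d} {ω : BondConfig (Site d)}
    (hc : c ∈ restrCluster a b v ω) (hc' : c' ∉ restrCluster a b v ω) (hadj : (openGraph ω).Adj c c') :
    s(c, c') = s(a, b) := by
  by_contra hne
  have hc2 : (openGraph (ω \ {s(a, b)})).Reachable v c := hc
  exact hc' (show (openGraph (ω \ {s(a, b)})).Reachable v c' from
    hc2.trans (SimpleGraph.Adj.reachable ((openGraph_sdiff_adj ω _ c c').2 ⟨hadj, hne⟩)))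

/-- Directed exit principle: when `b ∉ C̃^{(a,b)}(v)`, an open bond from inside `C̃` to outside is
the DIRECTED bond `(a,b)`. [cite: Slade2006LaceExpansion, (9.76)] -/
theorem eq_of_adj_of_mem_restrCluster {a b v c c' : Site d} {ω : BondConfig (Site d)}
    (hb : b ∉ restrCluster a b v ω) (hc : c ∈ restrCluster a b v ω) (hc' : c' ∉ restrCluster a b v ω)
    (hadj : (openGraph ω).Adj c c') : c = a ∧ c' = b := by
  rcases Sym2.eq_iff.1 (edge_eq_of_adj_of_mem_restrCluster hc hc' hadj) with h | ⟨rfl, rfl⟩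
  · exact h
  · exact absurd hc hb

/-- **Prefix decomposition.** An open path inside `B` from a vertex of `C̃ = C̃^{(a,b)}(v)` to a
vertex outside `C̃` (with `b ∉ C̃`) reaches `a` inside `C̃ ∩ B`, and `b ∈ B`. [cite: Slade2006LaceExpansion, (9.76)] -/
theorem pathIn_prefix_of_exit {a b v z y : Site d} {B : Set (Site d)} {ω : BondConfig (Site d)}
    (hb : b ∉ restrCluster a b v ω) (hz : z ∈ restrCluster a b v ω) (hy : y ∉ restrCluster a b v ω)
    (hp : PathIn (openGraph ω) B z y) :
    PathIn (openGraph ω) (restrCluster a b v ω ∩ B) z a ∧ b ∈ B := by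
  obtain ⟨c, c', hc, hc', hc'B, hadj, hpath⟩ := hp.exit hz hy
  obtain ⟨rfl, rfl⟩ := eq_of_adj_of_mem_restrCluster hb hc hc' hadj
  exact ⟨hpath, hc'B⟩

/-- **Suffix decomposition.** An open path inside `B` from a vertex of `C̃ = C̃^{(a,b)}(v)` to a
vertex outside `C̃` (with `b ∉ C̃`) has `a ∈ B` and ends with a path inside `B ∖ C̃` from `b`.
[cite: Slade2006LaceExpansion, (9.76)] -/
theorem pathIn_suffix_of_exit {a b v z y : Site d} {B : Set (Site d)} {ω : BondConfig (Site d)}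
    (hb : b ∉ restrCluster a b v ω) (hz : z ∈ restrCluster a b v ω) (hy : y ∉ restrCluster a b v ω)
    (hp : PathIn (openGraph ω) B z y) :
    a ∈ B ∧ PathIn (openGraph ω) (B \ restrCluster a b v ω) b y := by
  obtain ⟨c, c', hc, hcB, hc', hadj, hpath⟩ := hp.last_exit hz hy
  obtain ⟨rfl, rfl⟩ := eq_of_adj_of_mem_restrCluster hb hc hc' hadj
  exact ⟨hcB, hpath⟩

/-- If `a ∉ C̃^{(a',b')}(v)` then `C̃^{(a',b')}(v) ⊆ C̃^{(a,b)}(v)`: the open paths spanning the former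
avoid the vertex `a`, hence the bond `{a,b}`. [cite: HeydenreichVanDerHofstad2017, Def. 6.3(b)] -/
theorem restrCluster_subset_of_notMem {a b a' b' v : Site d} {ω : BondConfig (Site d)}
    (ha : a ∉ restrCluster a' b' v ω) : restrCluster a' b' v ω ⊆ restrCluster a b v ω := by
  intro z hz
  rw [mem_restrCluster_iff_pathIn] at hz ⊢
  have h1 := pathIn_restrict_cluster hz
  have ha' : a ∉ Set.univ ∩ {w | PathIn (openGraph (ω \ {s(a', b')})) Set.univ v w} :=
    fun h => ha (mem_restrCluster_iff_pathIn.2 h.2)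
  have h2 := pathIn_sdiff_of_notMem (e := s(a, b)) (Sym2.mem_mk_left a b) ha' h1
  exact (h2.mono_graph (openGraph_mono (Set.sdiff_subset_sdiff_left Set.sdiff_subset))).mono
    (Set.subset_univ _)

/-! ### Pivotal bonds -/

/-- The far endpoint `b` of a pivotal directed bond `(a,b)` for `v → x` lies outside `C̃^{(a,b)}(v)`.
[cite: Slade2006LaceExpansion, (9.76)] -/
theorem IsPivotalBond.notMem_fst {ω : BondConfig (Site d)} {v x a b : Site d}
    (h : IsPivotalBond ω v x a b) : b ∉ restrCluster a b v ω := by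
  obtain ⟨-, -, hbx⟩ := h
  exact (pathIn_of_mem_openConnIn hbx).left_mem

/-- The target `x` of a pivotal directed bond `(a,b)` for `v → x` lies outside `C̃^{(a,b)}(v)`.
[cite: HeydenreichVanDerHofstad2017, Def. 6.3(c)] -/
theorem IsPivotalBond.notMem_target {ω : BondConfig (Site d)} {v x a b : Site d}
    (h : IsPivotalBond ω v x a b) : x ∉ restrCluster a b v ω := by
  obtain ⟨-, -, hbx⟩ := h
  exact (pathIn_of_mem_openConnIn hbx).right_mem

/-- **A pivotal bond for `v → x` is open as soon as `v ↔ x`** (Def. 6.3(c): pivotal bonds are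
defined "occupied or not"; on `{v ↔ x}` they are occupied). [cite: HeydenreichVanDerHofstad2017, Def. 6.3(c)] -/
theorem mem_of_isPivotalBond {ω : BondConfig (Site d)} {v x a b : Site d} (hvx : ω ∈ openConn v x)
    (h : IsPivotalBond ω v x a b) : s(a, b) ∈ ω := by
  have hx : x ∉ restrCluster a b v ω := h.notMem_target
  have hp : PathIn (openGraph ω) Set.univ v x := pathIn_univ_iff_reachable.2 hvx
  obtain ⟨c, c', hc, hc', -, hadj, -⟩ := hp.exit (self_mem_restrCluster a b v ω) hx
  rw [← edge_eq_of_adj_of_mem_restrCluster hc hc' hadj]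
  exact ((openGraph_adj ω c c').1 hadj).1

/-- **Composition of pivotal bonds**: if the open bond `(a,b)` is pivotal for `v → x` and `(a',b')`
is pivotal for `v → a`, then `(a',b')` is pivotal for `v → x`.
[cite: HeydenreichVanDerHofstad2017, Lemma 6.5 (proof: the first pivotal bond)] -/
theorem IsPivotalBond.of_pivotal_left {ω : BondConfig (Site d)} {v x a b a' b' : Site d}
    (hab : s(a, b) ∈ ω) (h : IsPivotalBond ω v x a b) (h' : IsPivotalBond ω v a a' b') :
    IsPivotalBond ω v x a' b' := by
  obtain ⟨hadj, -, hbx⟩ := h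
  obtain ⟨hadj', ha', hb'a⟩ := h'
  have pa : PathIn (openGraph ω) (restrCluster a' b' v ω)ᶜ b' a := pathIn_of_mem_openConnIn hb'a
  have px : PathIn (openGraph ω) (restrCluster a b v ω)ᶜ b x := pathIn_of_mem_openConnIn hbx
  have haC' : a ∉ restrCluster a' b' v ω := pa.right_mem
  have hsub : restrCluster a' b' v ω ⊆ restrCluster a b v ω := restrCluster_subset_of_notMem haC'
  have hbC' : b ∉ restrCluster a' b' v ω := fun hb => px.left_mem (hsub hb)
  refine ⟨hadj', ha', mem_openConnIn_of_pathIn ?_⟩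
  exact (pa.tail ((openGraph_adj ω a b).2 ⟨hab, hadj.ne⟩) hbC').trans
    (px.mono (Set.compl_subset_compl.2 hsub))

/-- **Trichotomy (linear order) of pivotal bonds**: two pivotal directed bonds for `v → x` (with
`v ↔ x`) either coincide, or one of them is pivotal for the connection from `v` to the near end
of the other. [cite: HeydenreichVanDerHofstad2017, Lemma 6.5 (proof: "the first pivotal bond")] -/
theorem isPivotalBond_trichotomy {ω : BondConfig (Site d)} {v x a b a' b' : Site d}
    (hvx : ω ∈ openConn v x) (h : IsPivotalBond ω v x a b) (h' : IsPivotalBond ω v x a' b') :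
    (a = a' ∧ b = b') ∨ IsPivotalBond ω v a' a b ∨ IsPivotalBond ω v a a' b' := by
  have hab : s(a, b) ∈ ω := mem_of_isPivotalBond hvx h
  obtain ⟨hadj, ha, hbx⟩ := h
  obtain ⟨hadj', ha', hb'x⟩ := h'
  have px : PathIn (openGraph ω) (restrCluster a b v ω)ᶜ b x := pathIn_of_mem_openConnIn hbx
  have px' : PathIn (openGraph ω) (restrCluster a' b' v ω)ᶜ b' x := pathIn_of_mem_openConnIn hb'x
  have hbC : b ∉ restrCluster a b v ω := px.left_mem
  have hb'C' : b' ∉ restrCluster a' b' v ω := px'.left_mem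
  by_cases h1 : a' ∈ restrCluster a b v ω
  · by_cases h2 : a ∈ restrCluster a' b' v ω
    · -- each near end lies in the other's restricted cluster: the bonds coincide
      left
      by_contra hne
      have hne' : s(a, b) ≠ s(a', b') := by
        intro he
        rcases Sym2.eq_iff.1 he with h3 | ⟨rfl, rfl⟩
        · exact hne h3
        · exact hbC h1
      have hbC' : b ∈ restrCluster a' b' v ω := by
        have h2' : (openGraph (ω \ {s(a', b')})).Reachable v a := h2
        exact h2'.trans (SimpleGraph.Adj.reachable ((openGraph_sdiff_adj ω _ a b).2
          ⟨(openGraph_adj ω a b).2 ⟨hab, hadj.ne⟩, hne'⟩))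
      obtain ⟨hp, -⟩ := pathIn_prefix_of_exit hb'C' hbC' px'.right_mem px
      exact hp.right_mem.2 h1
    · -- `a ∉ C̃^{(a',b')}(v)`: `(a',b')` is pivotal for `v → a`
      right; right
      have pva : PathIn (openGraph ω) Set.univ v a :=
        pathIn_univ_iff_reachable.2 (reachable_of_mem_restrCluster ha)
      obtain ⟨-, hp⟩ := pathIn_suffix_of_exit hb'C' (self_mem_restrCluster a' b' v ω) h2 pva
      exact ⟨hadj', ha', mem_openConnIn_of_pathIn (hp.mono fun z hz => hz.2)⟩
  · -- `a' ∉ C̃^{(a,b)}(v)`: `(a,b)` is pivotal for `v → a'`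
    right; left
    have pva' : PathIn (openGraph ω) Set.univ v a' :=
      pathIn_univ_iff_reachable.2 (reachable_of_mem_restrCluster ha')
    obtain ⟨-, hp⟩ := pathIn_suffix_of_exit hbC (self_mem_restrCluster a b v ω) h1 pva'
    exact ⟨hadj, ha, mem_openConnIn_of_pathIn (hp.mono fun z hz => hz.2)⟩

/-! ### The event `E'(v, y; A)` -/

/-- `E'(v,y;A) ⊆ {v ↔ y through A}`. [cite: HeydenreichVanDerHofstad2017, (6.2.11)] -/
theorem connThrough_of_mem_laceE {ω : BondConfig (Site d)} {A : Set (Site d)} {v y : Site d}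
    (h : ω ∈ laceE A v y) : ω ∈ connThrough A v y :=
  ((mem_laceE_iff A v y ω).1 h).1

/-- On `E'(v,y;A)` no pivotal bond `(a,b)` for `v → y` has `v ↔ a through A`.
[cite: HeydenreichVanDerHofstad2017, (6.2.11)] -/
theorem not_connThrough_of_mem_laceE {ω : BondConfig (Site d)} {A : Set (Site d)} {v y a b : Site d}
    (h : ω ∈ laceE A v y) (hp : IsPivotalBond ω v y a b) : ω ∉ connThrough A v a :=
  ((mem_laceE_iff A v y ω).1 h).2 a b hp

/-! ### Lemma 6.5: the cutting-bond partition -/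

/-- **The pieces of the partition lie in `{v ↔ x through A}`**: if the open bond `(a,b)` is
pivotal for `v → x` and `E'(v,a;A)` holds, then `v ↔ x through A` (an open path from `v` to `x`
inside `ℤ^d ∖ A` would reach `a` inside `ℤ^d ∖ A`). [cite: HeydenreichVanDerHofstad2017, Lemma 6.5] -/
theorem connThrough_of_cut {ω : BondConfig (Site d)} {A : Set (Site d)} {v x a b : Site d}
    (hab : s(a, b) ∈ ω) (hp : IsPivotalBond ω v x a b) (hl : ω ∈ laceE A v a) :
    ω ∈ connThrough A v x := by
  obtain ⟨hadj, ha, hbx⟩ := hp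
  have px : PathIn (openGraph ω) (restrCluster a b v ω)ᶜ b x := pathIn_of_mem_openConnIn hbx
  have hva : (openGraph ω).Reachable v a := reachable_of_mem_restrCluster ha
  refine ⟨?_, fun hAx => ?_⟩
  · exact (hva.trans ((openGraph_adj ω a b).2 ⟨hab, hadj.ne⟩).reachable).trans (reachable_of_pathIn px)
  · have pAx : PathIn (openGraph ω) Aᶜ v x := pathIn_of_mem_openConnIn hAx
    obtain ⟨hpre, -⟩ :=
      pathIn_prefix_of_exit px.left_mem (self_mem_restrCluster a b v ω) px.right_mem pAx
    exact ((mem_connThrough_iff A v a ω).1 (connThrough_of_mem_laceE hl)).2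
      (mem_openConnIn_of_pathIn (hpre.mono Set.inter_subset_right))

/-- **The pieces miss `E'(v,x;A)`.** [cite: HeydenreichVanDerHofstad2017, Lemma 6.5] -/
theorem not_laceE_of_cut {ω : BondConfig (Site d)} {A : Set (Site d)} {v x a b : Site d}
    (hp : IsPivotalBond ω v x a b) (hl : ω ∈ laceE A v a) : ω ∉ laceE A v x :=
  fun h => not_connThrough_of_mem_laceE h hp (connThrough_of_mem_laceE hl)

/-- **Uniqueness of the cutting bond**: two pivotal bonds `(a,b)`, `(a',b')` for `v → x` with
`E'(v,a;A)` and `E'(v,a';A)` coincide (by the trichotomy, otherwise one would be a pivotal bond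
for `v → a'` through `A`, excluded by `E'(v,a';A)`). [cite: HeydenreichVanDerHofstad2017, Lemma 6.5] -/
theorem cuttingBond_unique {ω : BondConfig (Site d)} {A : Set (Site d)} {v x a b a' b' : Site d}
    (hvx : ω ∈ openConn v x) (hp : IsPivotalBond ω v x a b) (hl : ω ∈ laceE A v a)
    (hp' : IsPivotalBond ω v x a' b') (hl' : ω ∈ laceE A v a') : a = a' ∧ b = b' := by
  rcases isPivotalBond_trichotomy hvx hp hp' with h | h | h
  · exact h
  · exact absurd (connThrough_of_mem_laceE hl) (not_connThrough_of_mem_laceE hl' h)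
  · exact absurd (connThrough_of_mem_laceE hl') (not_connThrough_of_mem_laceE hl h)

/-- One step towards the cutting bond: if `(a,b)` is pivotal for `v → x` with `v ↔ a through A`
but `E'(v,a;A)` fails, there is a pivotal bond `(a',b')` for `v → x` with `v ↔ a' through A` whose
near end is STRICTLY CLOSER to `v` along a given open walk from `v` to `a` (the bond `(a',b')`,
pivotal for `v → a`, lies on that walk). [cite: HeydenreichVanDerHofstad2017, Lemma 6.5 (proof)] -/
theorem exists_cut_closer {ω : BondConfig (Site d)} {A : Set (Site d)} {v x a b : Site d}
    (hvx : ω ∈ openConn v x) (w : (openGraph ω).Walk v a) (hp : IsPivotalBond ω v x a b)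
    (hc : ω ∈ connThrough A v a) (hn : ω ∉ laceE A v a) :
    ∃ a' b', ∃ w' : (openGraph ω).Walk v a', w'.length < w.length ∧
      IsPivotalBond ω v x a' b' ∧ ω ∈ connThrough A v a' := by
  have h1 : ∃ a' b', IsPivotalBond ω v a a' b' ∧ ω ∈ connThrough A v a' := by
    by_contra hcon
    push Not at hcon
    exact hn ⟨hc, hcon⟩
  obtain ⟨a', b', hp', hc'⟩ := h1
  have hab : s(a, b) ∈ ω := mem_of_isPivotalBond hvx hp
  have haC' : a ∉ restrCluster a' b' v ω := hp'.notMem_target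
  have hb'C' : b' ∉ restrCluster a' b' v ω := hp'.notMem_fst
  obtain ⟨e, he, he1, he2⟩ :=
    w.exists_boundary_dart (restrCluster a' b' v ω) (self_mem_restrCluster a' b' v ω) haC'
  obtain ⟨hfst, -⟩ := eq_of_adj_of_mem_restrCluster hb'C' he1 he2 e.adj
  have hmem : a' ∈ w.support := hfst ▸ w.dart_fst_mem_support_of_mem_darts he
  have hne : a' ≠ a := by
    rintro rfl
    obtain ⟨-, ha', -⟩ := hp'
    exact haC' ha'
  exact ⟨a', b', w.takeUntil a' hmem, SimpleGraph.Walk.length_takeUntil_lt_length hmem hne,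
    IsPivotalBond.of_pivotal_left hab hp hp', hc'⟩

/-- **Existence of the cutting bond (Lemma 6.5, Exercise 6.3)**: on `{v ↔ x through A} ∖ E'(v,x;A)`
there is a pivotal bond `(a,b)` for `v → x` with `E'(v,a;A)` — the FIRST pivotal bond for `v → x`
with `v ↔ a through A` (induction on the length of an open walk from `v` to the near end).
[cite: HeydenreichVanDerHofstad2017, Lemma 6.5] [cite: Slade2006LaceExpansion, (10.22)] -/
theorem exists_cuttingBond {ω : BondConfig (Site d)} {A : Set (Site d)} {v x : Site d}
    (hvx : ω ∈ connThrough A v x) (hE : ω ∉ laceE A v x) :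
    ∃ a b, IsPivotalBond ω v x a b ∧ ω ∈ laceE A v a := by
  have hreach : ω ∈ openConn v x := connThrough_subset_openConn A v x hvx
  have h0 : ∃ a b, IsPivotalBond ω v x a b ∧ ω ∈ connThrough A v a := by
    by_contra hcon
    push Not at hcon
    exact hE ⟨hvx, hcon⟩
  obtain ⟨a, b, hpiv, hconn⟩ := h0
  suffices key : ∀ n : ℕ, ∀ a b : Site d, (∃ w : (openGraph ω).Walk v a, w.length ≤ n) →
      IsPivotalBond ω v x a b → ω ∈ connThrough A v a →
      ∃ a' b', IsPivotalBond ω v x a' b' ∧ ω ∈ laceE A v a' by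
    obtain ⟨-, ha, -⟩ := id hpiv
    obtain ⟨w⟩ := reachable_of_mem_restrCluster ha
    exact key w.length a b ⟨w, le_rfl⟩ hpiv hconn
  intro n
  induction n with
  | zero =>
    rintro a b ⟨w, hw⟩ hp hc
    by_cases hl : ω ∈ laceE A v a
    · exact ⟨a, b, hp, hl⟩
    · obtain ⟨a', b', w', hlt, -, -⟩ := exists_cut_closer hreach w hp hc hl
      omega
  | succ n ih =>
    rintro a b ⟨w, hw⟩ hp hc
    by_cases hl : ω ∈ laceE A v a
    · exact ⟨a, b, hp, hl⟩
    · obtain ⟨a', b', w', hlt, hp', hc'⟩ := exists_cut_closer hreach w hp hc hl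
      exact ih a' b' ⟨w', by omega⟩ hp' hc'

/-- **Lemma 6.5 (cutting-bond partition), pointwise form**: `v ↔ x through A` iff either
`E'(v,x;A)`, or for some directed bond `(a,b)`: `(a,b)` is occupied, pivotal for `v → x`, and
`E'(v,a;A)` (the event `E(v,a,b,x;A)` of (6.2.12)); the alternatives are mutually exclusive by
`not_laceE_of_cut` and `cuttingBond_unique`.
[cite: HeydenreichVanDerHofstad2017, Lemma 6.5 ((6.2.21))] [cite: Slade2006LaceExpansion, (10.22)] -/
theorem mem_connThrough_iff_laceE_or_cut (ω : BondConfig (Site d)) (A : Set (Site d)) (v x : Site d) :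
    ω ∈ connThrough A v x ↔ ω ∈ laceE A v x ∨
      ∃ a b, s(a, b) ∈ ω ∧ IsPivotalBond ω v x a b ∧ ω ∈ laceE A v a := by
  constructor
  · intro h
    by_cases hE : ω ∈ laceE A v x
    · exact Or.inl hE
    · obtain ⟨a, b, hp, hl⟩ := exists_cuttingBond h hE
      exact Or.inr ⟨a, b, mem_of_isPivotalBond (connThrough_subset_openConn A v x h) hp, hp, hl⟩
  · rintro (h | ⟨a, b, hab, hp, hl⟩)
    · exact connThrough_of_mem_laceE h
    · exact connThrough_of_cut hab hp hl

end Literature.Barriers.CriticalPhenomena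

end
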